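import Mathlib.Analysis.InnerProductSpace.Calculus
import Mathlib.Analysis.SpecialFunctions.Sqrt
import Literature.MathematicalPhysics.KineticTheory.MicroscaleWindowFunctionals
import Literature.MathematicalPhysics.KineticTheory.CollisionTubeWeightOscillation
import Literature.MathematicalPhysics.KineticTheory.EvenStatTruncationBound
import Literature.Analysis.FluidPDE.HardSphereTorusMeasure
import HarnessLib

/-!
# Cluster transport identity, I: the cone-mollified density along a free flight
# (helper file of `stub_clusterTransport`, line `stationary-microscale-hierarchy-entrance-law` of the
# crux `JParityClosure.EvenStressEnskog`, stmt-AtomisticToContinuum-13079)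

Calculus of the cone-mollified empirical density `ρ_r(S_s w, x₀)` (the configuration-dependent part
of the weight `W = χ(s, x₀) g(σ³ ρ_r)` of the Eulerian microscale windows) at a FIXED window centre
`x₀ ∈ 𝕋³` along a free flight `s ↦ S_s w` of `N + 1` hard spheres (`ρ_r = mollDensity r`, cone
kernel `b_r = coneKernel r`, `0 < r < 1/2`):

* the minimal image `reprSym` of the flat torus is continuous in the chart `‖reprSym x‖ < 1/2`
  (`continuousAt_reprSym_of_norm_lt`) and additive along short flights
  (`reprSym_flight_eventuallyEq`);
* the cone kernel `s ↦ b_r(y + s v, x₀)` is differentiable at `s = 0` whenever the centre `x₀` is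
  neither ON the sphere `dist(y, x₀) = r` nor AT `y`, with derivative
  `-3/(πr⁴) ⟪sep(y, x₀), v⟫ / dist(y, x₀)` inside the cone and `0` outside
  (`hasDerivAt_coneKernel_flight`); the exceptional centres of a configuration are Haar-null
  (`ae_forall_euclidDist_ne`);
* hence `s ↦ ρ_r(S_s w, x₀)` has the derivative `densRate r (S_t w) x₀` at every `t` for every
  good centre of `S_t w` (`hasDerivAt_mollDensity_flight`), is Lipschitz in `s` with constant
  `3/(πr⁴) Σ_k ‖v_k‖` for EVERY centre (`abs_mollDensity_flight_sub_le`), and its rate `densRate` is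
  continuous along the flight at good centres and bounded by `3/(πr⁴) Σ_k ‖v_k‖`
  (`continuousAt_densRate_flight`, `abs_densRate_le`).

References: H. Spohn, *Large Scale Dynamics of Interacting Particles* (1991), Part I §3.2 (empirical
fields tested against space–time functions). All statements are elementary calculus. [folklore]
-/

noncomputable section

open MeasureTheory Set Filter Function Metric
open scoped BigOperators Topology InnerProductSpace

namespace Summit.AtomisticToContinuum.HydrodynamicLimit.Theorems.EvenStressEnskog

open Literature.Analysis.FluidPDE Literature.Analysis.FunctionSpaces
  Literature.MathematicalPhysics.KineticTheory
  Literature.MathematicalPhysics.KineticTheory.StationaryMicroscale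

/-! ## The minimal image in the chart `‖·‖ < 1/2` -/

/-- The symmetric representative `reprSym : 𝕋³ → ℝ³` is continuous at every point of the open
chart `‖reprSym x‖ < 1/2` (inside the injectivity radius the minimal image is additive,
`Torus.reprSym_add_proj_of_norm_lt`). [folklore] -/
theorem continuousAt_reprSym_of_norm_lt {x : T3} (hx : ‖Torus.reprSym x‖ < 1 / 2) :
    ContinuousAt (Torus.reprSym : T3 → V3) x := by
  have h0 : Tendsto (fun y : T3 => ‖Torus.reprSym (y - x)‖) (𝓝 x) (𝓝 0) := by
    have hc : Continuous fun y : T3 => ‖Torus.reprSym (y - x)‖ :=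
      Torus.continuous_norm_reprSym.comp (continuous_id.sub continuous_const)
    simpa using hc.tendsto x
  have hev : ∀ᶠ y in 𝓝 x, Torus.reprSym y = Torus.reprSym x + Torus.reprSym (y - x) := by
    have h1 : ∀ᶠ y in 𝓝 x, ‖Torus.reprSym (y - x)‖ < 1 / 2 - ‖Torus.reprSym x‖ :=
      h0.eventually (Iio_mem_nhds (by linarith))
    filter_upwards [h1] with y hy
    have key := Torus.reprSym_add_proj_of_norm_lt (x := x) (s := Torus.reprSym (y - x))
      (by linarith)
    rwa [Torus.proj_reprSym, add_sub_cancel] at key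
  rw [ContinuousAt, tendsto_iff_norm_sub_tendsto_zero]
  refine h0.congr' ?_
  filter_upwards [hev] with y hy
  rw [hy, add_sub_cancel_left]

/-- The minimal-image distance to a fixed centre is continuous along a flight `s ↦ y + s v`.
[folklore] -/
theorem continuous_euclidDist_flight (y x₀ : T3) (v : V3) :
    Continuous fun s : ℝ => Torus.euclidDist (y + Torus.proj (s • v)) x₀ := by
  have h : Continuous fun s : ℝ => (y + Torus.proj (s • v), x₀) :=
    (continuous_const.add
      (Torus.continuous_proj.comp (continuous_id.smul continuous_const))).prodMk continuous_const
  simpa only [Function.comp_def] using Torus.continuous_euclidDist.comp h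

/-- Along a short flight from a point at minimal-image distance `< 1/2` from the centre, the
minimal-image separation is affine: `sep(y + s v, x₀) = sep(y, x₀) + s v` for `s` near `0`.
[folklore] -/
theorem reprSym_flight_eventuallyEq {y x₀ : T3} (v : V3) (h : Torus.euclidDist y x₀ < 1 / 2) :
    ∀ᶠ s : ℝ in 𝓝 0,
      Torus.reprSym (y + Torus.proj (s • v) - x₀) = Torus.reprSym (y - x₀) + s • v := by
  have hs : Tendsto (fun s : ℝ => ‖s • v‖) (𝓝 0) (𝓝 0) := by
    have : Continuous fun s : ℝ => ‖s • v‖ := (continuous_id.smul continuous_const).norm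
    simpa using this.tendsto 0
  filter_upwards [hs.eventually (Iio_mem_nhds (sub_pos.2 h))] with s hs'
  have e : y + Torus.proj (s • v) - x₀ = (y - x₀) + Torus.proj (s • v) := by abel
  rw [e]
  refine Torus.reprSym_add_proj_of_norm_lt ?_
  rw [Torus.euclidDist_eq] at h hs'
  linarith

/-! ## The cone kernel along a free flight -/

/-- Derivative of the Euclidean norm along a line: `d/ds ‖ξ + s v‖ = ⟪ξ + s v, v⟫ / ‖ξ + s v‖`
away from the origin. [folklore] -/
theorem hasDerivAt_norm_add_smul (ξ v : V3) {s : ℝ} (h : ξ + s • v ≠ 0) :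
    HasDerivAt (fun s : ℝ => ‖ξ + s • v‖) (⟪ξ + s • v, v⟫_ℝ / ‖ξ + s • v‖) s := by
  have h1 : HasDerivAt (fun s : ℝ => ξ + s • v) v s := by
    simpa using ((hasDerivAt_id s).smul_const v).const_add ξ
  have h2 := h1.norm_sq
  have hne : ‖ξ + s • v‖ ^ 2 ≠ 0 := pow_ne_zero 2 (norm_ne_zero_iff.2 h)
  have h3 := h2.sqrt hne
  have hfun : (fun y : ℝ => Real.sqrt (‖ξ + y • v‖ ^ 2)) = fun y => ‖ξ + y • v‖ := by
    funext y
    exact Real.sqrt_sq (norm_nonneg _)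
  rw [hfun, Real.sqrt_sq (norm_nonneg _)] at h3
  convert h3 using 1
  have hn : ‖ξ + s • v‖ ≠ 0 := norm_ne_zero_iff.2 h
  field_simp

/-- **The cone kernel along a flight.** For `0 < r < 1/2` and a centre `x₀` neither on the
sphere `dist(y, x₀) = r` nor at `y`, `s ↦ b_r(y + s v, x₀)` is differentiable at `s = 0` with
derivative `-3/(πr⁴) ⟪sep(y, x₀), v⟫ / dist(y, x₀)` if `dist(y, x₀) < r` and `0` if
`dist(y, x₀) > r` (the kernel vanishes identically nearby). [folklore] -/
theorem hasDerivAt_coneKernel_flight {r : ℝ} (hr : 0 < r) (hr2 : r < 1 / 2) (y x₀ : T3) (v : V3)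
    (h0 : Torus.euclidDist y x₀ ≠ 0) (hne : Torus.euclidDist y x₀ ≠ r) :
    HasDerivAt (fun s : ℝ => coneKernel r (y + Torus.proj (s • v)) x₀)
      (if 0 < Torus.euclidDist y x₀ ∧ Torus.euclidDist y x₀ < r then
        -(3 / (Real.pi * r ^ 4)) * ⟪(Torus.geometry (Fin 3)).sepVec y x₀, v⟫_ℝ /
          Torus.euclidDist y x₀
       else 0) 0 := by
  have hdpos : 0 < Torus.euclidDist y x₀ := lt_of_le_of_ne (norm_nonneg _) (Ne.symm h0)
  have hcont := continuous_euclidDist_flight y x₀ v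
  have hval : Torus.euclidDist (y + Torus.proj ((0 : ℝ) • v)) x₀ = Torus.euclidDist y x₀ := by
    simp
  have htend : Tendsto (fun s : ℝ => Torus.euclidDist (y + Torus.proj (s • v)) x₀) (𝓝 0)
      (𝓝 (Torus.euclidDist y x₀)) := by
    simpa [hval] using hcont.tendsto 0
  rcases lt_or_gt_of_ne hne with hlt | hgt
  · -- inside the cone
    rw [if_pos ⟨hdpos, hlt⟩, Torus.geometry_sepVec]
    have hξ : Torus.reprSym (y - x₀) ≠ 0 := by
      intro h
      apply h0
      rw [Torus.euclidDist_eq, h, norm_zero]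
    have hev1 := reprSym_flight_eventuallyEq v (hlt.trans hr2)
    have hev2 : ∀ᶠ s : ℝ in 𝓝 0, Torus.euclidDist (y + Torus.proj (s • v)) x₀ < r :=
      htend.eventually (Iio_mem_nhds hlt)
    have h1 := hasDerivAt_norm_add_smul (Torus.reprSym (y - x₀)) v (s := 0) (by simpa using hξ)
    have hderiv := ((h1.div_const r).const_sub 1).const_mul (3 / (Real.pi * r ^ 3))
    simp only [zero_smul, add_zero] at hderiv
    have hderiv' : HasDerivAt
        (fun s : ℝ => 3 / (Real.pi * r ^ 3) * (1 - ‖Torus.reprSym (y - x₀) + s • v‖ / r))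
        (-(3 / (Real.pi * r ^ 4)) * ⟪Torus.reprSym (y - x₀), v⟫_ℝ / Torus.euclidDist y x₀) 0 := by
      refine hderiv.congr_deriv ?_
      rw [Torus.euclidDist_eq]
      have hn : ‖Torus.reprSym (y - x₀)‖ ≠ 0 := norm_ne_zero_iff.2 hξ
      field_simp
    refine hderiv'.congr_of_eventuallyEq ?_
    filter_upwards [hev1, hev2] with s hs1 hs2
    show coneKernel r (y + Torus.proj (s • v)) x₀ =
      3 / (Real.pi * r ^ 3) * (1 - ‖Torus.reprSym (y - x₀) + s • v‖ / r)
    unfold coneKernel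
    rw [Torus.euclidDist_eq, hs1] at hs2 ⊢
    rw [max_eq_left]
    rw [sub_nonneg, div_le_one hr]
    exact hs2.le
  · -- outside the cone: the kernel vanishes nearby
    rw [if_neg (fun h => (not_lt.2 hgt.le) h.2)]
    have hev : ∀ᶠ s : ℝ in 𝓝 0, r < Torus.euclidDist (y + Torus.proj (s • v)) x₀ :=
      htend.eventually (Ioi_mem_nhds hgt)
    refine (hasDerivAt_const (0 : ℝ) (0 : ℝ)).congr_of_eventuallyEq ?_
    filter_upwards [hev] with s hs
    show coneKernel r (y + Torus.proj (s • v)) x₀ = 0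
    unfold coneKernel
    rw [max_eq_right, mul_zero]
    rw [sub_nonpos, one_le_div hr]
    exact hs.le

/-! ## The bad centres of a configuration are null -/

/-- **Almost every window centre is good**: for `r ≠ 0` and Haar-a.e. `x₀ ∈ 𝕋³`, every particle of
the configuration `w` is at minimal-image distance `≠ 0` and `≠ r` from `x₀` (finitely many
minimal-image spheres, `Torus.volume_euclidDist_eq`, and points are null). [folklore] -/
theorem ae_forall_euclidDist_ne :
    ∀ {N : ℕ} {r : ℝ}, r ≠ 0 → ∀ w : Config (N + 1) (Fin 3) T3, ∀ᵐ x₀ : T3, ∀ k : Fin (N + 1),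
      Torus.euclidDist (w k).1 x₀ ≠ 0 ∧ Torus.euclidDist (w k).1 x₀ ≠ r := by
  intro N r hr w
  refine ae_all_iff.2 fun k => ?_
  rw [ae_iff]
  have e : {x₀ : T3 | ¬(Torus.euclidDist (w k).1 x₀ ≠ 0 ∧ Torus.euclidDist (w k).1 x₀ ≠ r)} =
      {x : T3 | Torus.reprSym (x - (w k).1) ∈ Metric.sphere (0 : V3) 0} ∪
        {x : T3 | Torus.euclidDist x (w k).1 = r} := by
    ext x
    simp only [not_and_or, not_not, mem_setOf_eq, mem_union, mem_sphere_zero_iff_norm,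
      Torus.euclidDist_comm (w k).1 x]
    rfl
  rw [e]
  refine measure_union_null ?_ (Torus.volume_euclidDist_eq hr (w k).1)
  rw [Torus.volume_reprSym_sub_mem (w k).1 isClosed_sphere.measurableSet]
  exact measure_mono_null inter_subset_left (Measure.addHaar_sphere volume (0 : V3) 0)

/-! ## The mollified density along a free flight -/

/-- **The free-streaming rate of the mollified density**: for `0 < r < 1/2` and a GOOD centre
`x₀` of `w` (every particle at distance `≠ 0`, `≠ r`), `s ↦ ρ_r(S_s w, x₀)` is differentiable at
`s = 0` with derivative `densRate r w x₀`. [folklore] -/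
theorem hasDerivAt_mollDensity_flight_zero {N : ℕ} {r : ℝ} (hr : 0 < r) (hr2 : r < 1 / 2)
    (w : Config (N + 1) (Fin 3) T3) {x₀ : T3}
    (hx : ∀ k, Torus.euclidDist (w k).1 x₀ ≠ 0 ∧ Torus.euclidDist (w k).1 x₀ ≠ r) :
    HasDerivAt (fun s : ℝ => mollDensity r (freeFlight (Torus.geometry (Fin 3)) s w) x₀)
      (densRate r w x₀) 0 := by
  have hk : ∀ k : Fin (N + 1), HasDerivAt
      (fun s : ℝ => coneKernel r ((w k).1 + Torus.proj (s • (w k).2)) x₀)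
      (if 0 < Torus.euclidDist (w k).1 x₀ ∧ Torus.euclidDist (w k).1 x₀ < r then
        -(3 / (Real.pi * r ^ 4)) * ⟪(Torus.geometry (Fin 3)).sepVec (w k).1 x₀, (w k).2⟫_ℝ /
          Torus.euclidDist (w k).1 x₀
       else 0) 0 := fun k =>
    hasDerivAt_coneKernel_flight hr hr2 _ _ _ (hx k).1 (hx k).2
  have hsum := (HasDerivAt.fun_sum (u := Finset.univ) fun k _ => hk k).const_mul
    (((N + 1 : ℕ) : ℝ)⁻¹)
  simp only [mollDensity_eq_avg, freeFlight_apply, Torus.geometry_translate]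
  refine hsum.congr_deriv ?_
  unfold densRate
  push_cast
  rfl

/-- The same at every time `t` of the flight, for a good centre of `S_t w`. [folklore] -/
theorem hasDerivAt_mollDensity_flight {N : ℕ} {r : ℝ} (hr : 0 < r) (hr2 : r < 1 / 2)
    (w : Config (N + 1) (Fin 3) T3) (t : ℝ) {x₀ : T3}
    (hx : ∀ k, Torus.euclidDist ((freeFlight (Torus.geometry (Fin 3)) t w) k).1 x₀ ≠ 0 ∧
      Torus.euclidDist ((freeFlight (Torus.geometry (Fin 3)) t w) k).1 x₀ ≠ r) :
    HasDerivAt (fun s : ℝ => mollDensity r (freeFlight (Torus.geometry (Fin 3)) s w) x₀)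
      (densRate r (freeFlight (Torus.geometry (Fin 3)) t w) x₀) t := by
  have h0 := hasDerivAt_mollDensity_flight_zero hr hr2 (freeFlight (Torus.geometry (Fin 3)) t w) hx
  simp only [← freeFlight_add] at h0
  have h0' : HasDerivAt
      (fun s : ℝ => mollDensity r (freeFlight (Torus.geometry (Fin 3)) (s + t) w) x₀)
      (densRate r (freeFlight (Torus.geometry (Fin 3)) t w) x₀) (t - t) := by
    rwa [sub_self]
  have h1 := h0'.comp_sub_const t t
  simpa only [sub_add_cancel] using h1

/-- **The mollified density is Lipschitz in time along a flight, uniformly in the centre**: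
`|ρ_r(S_s w, x₀) − ρ_r(S_{s'} w, x₀)| ≤ 3/(πr⁴) (Σ_k ‖v_k‖) |s − s'|` (the cone kernel is
`3/(πr⁴)`-Lipschitz for the minimal-image distance and particle `k` moves at speed `‖v_k‖`).
[folklore] -/
theorem abs_mollDensity_flight_sub_le {N : ℕ} {r : ℝ} (hr : 0 < r) (w : Config (N + 1) (Fin 3) T3)
    (x₀ : T3) (s s' : ℝ) :
    |mollDensity r (freeFlight (Torus.geometry (Fin 3)) s w) x₀ -
        mollDensity r (freeFlight (Torus.geometry (Fin 3)) s' w) x₀| ≤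
      3 / (Real.pi * r ^ 4) * (∑ k, ‖(w k).2‖) * |s - s'| := by
  have h := abs_mollDensity_sub_le hr (freeFlight (Torus.geometry (Fin 3)) s w)
    (freeFlight (Torus.geometry (Fin 3)) s' w) x₀ x₀
  rw [Torus.euclidDist_self, add_zero] at h
  refine h.trans ?_
  have hk : ∀ k : Fin (N + 1),
      Torus.euclidDist ((freeFlight (Torus.geometry (Fin 3)) s w) k).1
        ((freeFlight (Torus.geometry (Fin 3)) s' w) k).1 ≤ ‖(w k).2‖ * |s - s'| := by
    intro k
    simp only [freeFlight_apply, Torus.geometry_translate]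
    calc Torus.euclidDist ((w k).1 + Torus.proj (s • (w k).2)) ((w k).1 + Torus.proj (s' • (w k).2))
        ≤ Torus.euclidDist (w k).1 (w k).1 + ‖s • (w k).2 - s' • (w k).2‖ :=
          Torus.euclidDist_translate_le _ _ _ _
      _ = ‖(w k).2‖ * |s - s'| := by
          rw [Torus.euclidDist_self, zero_add, ← sub_smul, norm_smul, Real.norm_eq_abs, mul_comm]
  have hN : ((N + 1 : ℕ) : ℝ)⁻¹ ≤ 1 := inv_le_one_of_one_le₀ (by exact_mod_cast Nat.succ_pos N)
  have hsum : 0 ≤ ∑ k : Fin (N + 1), Torus.euclidDist ((freeFlight (Torus.geometry (Fin 3)) s w) k).1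
      ((freeFlight (Torus.geometry (Fin 3)) s' w) k).1 :=
    Finset.sum_nonneg fun k _ => norm_nonneg _
  calc 3 / (Real.pi * r ^ 4) * (((N + 1 : ℕ) : ℝ)⁻¹ *
        ∑ k : Fin (N + 1), Torus.euclidDist ((freeFlight (Torus.geometry (Fin 3)) s w) k).1
          ((freeFlight (Torus.geometry (Fin 3)) s' w) k).1)
      ≤ 3 / (Real.pi * r ^ 4) * ∑ k : Fin (N + 1), ‖(w k).2‖ * |s - s'| := by
        gcongr 3 / (Real.pi * r ^ 4) * ?_
        exact (mul_le_of_le_one_left hsum hN).trans (Finset.sum_le_sum fun k _ => hk k)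
    _ = 3 / (Real.pi * r ^ 4) * (∑ k, ‖(w k).2‖) * |s - s'| := by
        rw [← Finset.sum_mul]
        ring

/-- The mollified density takes values in `[0, 3/(πr³)]` (`r > 0`). [folklore] -/
theorem mollDensity_mem_Icc {N : ℕ} {r : ℝ} (hr : 0 < r) (w : Config (N + 1) (Fin 3) T3) (x₀ : T3) :
    mollDensity r w x₀ ∈ Icc 0 (3 / (Real.pi * r ^ 3)) :=
  ⟨Literature.MathematicalPhysics.KineticTheory.mollDensity_nonneg hr w x₀, mollDensity_le hr w x₀⟩

/-! ## The free-streaming rate `densRate` -/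

/-- One summand of `densRate` read along a flight `s ↦ y + s v` is continuous at `s = 0` whenever
the centre is neither on the sphere `dist(y, x₀) = r` nor at `y` (inside the cone the minimal image
is affine in `s`, outside the summand vanishes nearby). [folklore] -/
theorem continuousAt_densRate_summand_flight {r : ℝ} (hr2 : r < 1 / 2) (y x₀ : T3) (v : V3)
    (h0 : Torus.euclidDist y x₀ ≠ 0) (hne : Torus.euclidDist y x₀ ≠ r) :
    ContinuousAt (fun s : ℝ =>
      if 0 < Torus.euclidDist (y + Torus.proj (s • v)) x₀ ∧
          Torus.euclidDist (y + Torus.proj (s • v)) x₀ < r then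
        -(3 / (Real.pi * r ^ 4)) *
            ⟪(Torus.geometry (Fin 3)).sepVec (y + Torus.proj (s • v)) x₀, v⟫_ℝ /
          Torus.euclidDist (y + Torus.proj (s • v)) x₀
      else 0) 0 := by
  have hdpos : 0 < Torus.euclidDist y x₀ := lt_of_le_of_ne (norm_nonneg _) (Ne.symm h0)
  have hcont := continuous_euclidDist_flight y x₀ v
  have htend : Tendsto (fun s : ℝ => Torus.euclidDist (y + Torus.proj (s • v)) x₀) (𝓝 0)
      (𝓝 (Torus.euclidDist y x₀)) := by
    simpa using hcont.tendsto 0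
  rcases lt_or_gt_of_ne hne with hlt | hgt
  · have hev1 := reprSym_flight_eventuallyEq v (hlt.trans hr2)
    have hev2 : ∀ᶠ s : ℝ in 𝓝 0, Torus.euclidDist (y + Torus.proj (s • v)) x₀ < r :=
      htend.eventually (Iio_mem_nhds hlt)
    have hev3 : ∀ᶠ s : ℝ in 𝓝 0, 0 < Torus.euclidDist (y + Torus.proj (s • v)) x₀ :=
      htend.eventually (Ioi_mem_nhds hdpos)
    have hbr : ContinuousAt (fun s : ℝ =>
        -(3 / (Real.pi * r ^ 4)) * ⟪Torus.reprSym (y - x₀) + s • v, v⟫_ℝ /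
          Torus.euclidDist (y + Torus.proj (s • v)) x₀) 0 := by
      refine ((continuous_const.mul ((continuous_const.add
        (continuous_id.smul continuous_const)).inner continuous_const)).continuousAt).div
        hcont.continuousAt ?_
      simpa using h0
    refine hbr.congr ?_
    filter_upwards [hev1, hev2, hev3] with s hs1 hs2 hs3
    rw [if_pos ⟨hs3, hs2⟩, Torus.geometry_sepVec, hs1]
  · have hev : ∀ᶠ s : ℝ in 𝓝 0, r < Torus.euclidDist (y + Torus.proj (s • v)) x₀ :=
      htend.eventually (Ioi_mem_nhds hgt)
    refine (continuousAt_const (y := (0 : ℝ))).congr ?_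
    filter_upwards [hev] with s hs
    rw [if_neg (fun h => (not_lt.2 hs.le) h.2)]

/-- **Continuity of the free-streaming rate along a flight**: for a good centre of `w`,
`s ↦ densRate r (S_s w) x₀` is continuous at `s = 0`. [folklore] -/
theorem continuousAt_densRate_flight_zero {N : ℕ} {r : ℝ} (hr2 : r < 1 / 2)
    (w : Config (N + 1) (Fin 3) T3) {x₀ : T3}
    (hx : ∀ k, Torus.euclidDist (w k).1 x₀ ≠ 0 ∧ Torus.euclidDist (w k).1 x₀ ≠ r) :
    ContinuousAt (fun s : ℝ => densRate r (freeFlight (Torus.geometry (Fin 3)) s w) x₀) 0 := by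
  unfold densRate
  simp only [freeFlight_apply, Torus.geometry_translate]
  refine continuousAt_const.mul ?_
  have hk := fun k : Fin (N + 1) => continuousAt_densRate_summand_flight hr2 (w k).1 x₀ (w k).2
    (hx k).1 (hx k).2
  simp only [ContinuousAt] at hk ⊢
  exact tendsto_finsetSum _ fun k _ => hk k

/-- The same at every time `t`, for a good centre of `S_t w`. [folklore] -/
theorem continuousAt_densRate_flight {N : ℕ} {r : ℝ} (hr2 : r < 1 / 2)
    (w : Config (N + 1) (Fin 3) T3) (t : ℝ) {x₀ : T3}
    (hx : ∀ k, Torus.euclidDist ((freeFlight (Torus.geometry (Fin 3)) t w) k).1 x₀ ≠ 0 ∧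
      Torus.euclidDist ((freeFlight (Torus.geometry (Fin 3)) t w) k).1 x₀ ≠ r) :
    ContinuousAt (fun s : ℝ => densRate r (freeFlight (Torus.geometry (Fin 3)) s w) x₀) t := by
  have h0 := continuousAt_densRate_flight_zero hr2 (freeFlight (Torus.geometry (Fin 3)) t w) hx
  simp only [← freeFlight_add] at h0
  have h0' : ContinuousAt
      (fun s : ℝ => densRate r (freeFlight (Torus.geometry (Fin 3)) (s + t) w) x₀) (t - t) := by
    rwa [sub_self]
  have h1 := h0'.comp (f := fun s : ℝ => s - t) (continuous_id.sub continuous_const).continuousAt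
  simpa only [Function.comp_def, sub_add_cancel] using h1

/-- **Bound on the free-streaming rate**: `|densRate r w x₀| ≤ 3/(πr⁴) Σ_k ‖v_k‖`
(`|⟪ξ, v⟫| / ‖ξ‖ ≤ ‖v‖`). [folklore] -/
theorem abs_densRate_le {N : ℕ} {r : ℝ} (hr : 0 < r) (w : Config (N + 1) (Fin 3) T3) (x₀ : T3) :
    |densRate r w x₀| ≤ 3 / (Real.pi * r ^ 4) * ∑ k, ‖(w k).2‖ := by
  unfold densRate
  have hC : 0 ≤ 3 / (Real.pi * r ^ 4) := by positivity
  have hk : ∀ k : Fin (N + 1),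
      |(if 0 < Torus.euclidDist (w k).1 x₀ ∧ Torus.euclidDist (w k).1 x₀ < r then
          -(3 / (Real.pi * r ^ 4)) * ⟪(Torus.geometry (Fin 3)).sepVec (w k).1 x₀, (w k).2⟫_ℝ /
            Torus.euclidDist (w k).1 x₀ else 0)| ≤ 3 / (Real.pi * r ^ 4) * ‖(w k).2‖ := by
    intro k
    split_ifs with h
    · rw [abs_div, abs_mul, abs_neg, abs_of_nonneg hC, abs_of_pos h.1, mul_div_assoc]
      refine mul_le_mul_of_nonneg_left ?_ hC
      rw [div_le_iff₀ h.1, ← Torus.norm_geometry_sepVec, mul_comm]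
      exact abs_real_inner_le_norm _ _
    · rw [abs_zero]
      positivity
  have hN : ((N : ℝ) + 1)⁻¹ ≤ 1 := inv_le_one_of_one_le₀ (by linarith [(Nat.cast_nonneg N : (0 : ℝ) ≤ N)])
  have hN0 : 0 ≤ ((N : ℝ) + 1)⁻¹ := inv_nonneg.2 (by positivity)
  rw [abs_mul, abs_of_nonneg hN0]
  calc ((N : ℝ) + 1)⁻¹ * |∑ k : Fin (N + 1), _| ≤ 1 * ∑ k : Fin (N + 1), 3 / (Real.pi * r ^ 4) * ‖(w k).2‖ :=
        mul_le_mul hN ((Finset.abs_sum_le_sum_abs _ _).trans (Finset.sum_le_sum fun k _ => hk k))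
          (abs_nonneg _) zero_le_one
    _ = 3 / (Real.pi * r ^ 4) * ∑ k, ‖(w k).2‖ := by rw [one_mul, Finset.mul_sum]

/-- The free-streaming rate is Borel measurable in the centre. [folklore] -/
theorem measurable_densRate {N : ℕ} (r : ℝ) (w : Config (N + 1) (Fin 3) T3) :
    Measurable fun x₀ : T3 => densRate r w x₀ := by
  unfold densRate
  refine measurable_const.mul (Finset.measurable_sum _ fun k _ => ?_)
  have h2 : Continuous fun x₀ : T3 => ((w k).1, x₀) := by fun_prop
  have hd : Continuous fun x₀ : T3 => Torus.euclidDist (w k).1 x₀ := by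
    simpa only [Function.comp_def] using Torus.continuous_euclidDist.comp h2
  refine Measurable.ite ?_ ?_ measurable_const
  · exact (measurableSet_lt measurable_const hd.measurable).inter
      (measurableSet_lt hd.measurable measurable_const)
  · refine (measurable_const.mul ?_).div hd.measurable
    simp only [Torus.geometry_sepVec]
    exact (Torus.measurable_reprSym.comp (measurable_const.sub measurable_id)).inner
      measurable_const

end Summit.AtomisticToContinuum.HydrodynamicLimit.Theorems.EvenStressEnskog

end
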